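/-
Copyright (c) 2026. All rights reserved.
Released under Apache 2.0 license as described in the file LICENSE.
-/
import Literature.AlgebraicGeometry.Pohlmann1968.DegenerateCMTypesAbelianCMFieldPrimePower
import Mathlib.Analysis.Fourier.FiniteAbelian.PontryaginDuality
import HarnessLib

/-!
# Large rank forces simplicity: a non-primitive CM type of an abelian CM field of degree `2p^k` has
# rank at most `p^{k−1} + 1` (character counting on an abelian group of order `2p^k`)

T. Kubota's Lemma 2 [Kubota1965]: `rank(S) = 1 + #{χ odd : χ(S) ≠ 0}`.  If `uS = S` for some `u ≠ 1`, then
`χ(S) = χ(u)χ(S)`, so every odd character with `χ(u) ≠ 1` vanishes on `S`; passing to `v = u²` (of order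
`p^e ≥ p` — an involution never stabilises a CM type, a group of order `2p^k` having the single involution `ρ`),
only the `p^{k−e}` odd characters trivial at `v` can survive: **`rank(S) ≤ p^{k−e} + 1 ≤ p^{k−1} + 1`**.  The
character counts (`ord(w)·#{χ : χ(w) = 1} = |G|`, uniqueness of the involution, `#{χ odd : χ(v) = 1} = p^{k−e}`)
are obtained from the orthogonality relation `Σ_χ χ(a) = |G|·[a = 0]` (Mathlib's `AddChar.sum_apply_eq_ite`).
For CM fields (Shimura's criterion, tree `isSimple_iff_isPrimitive`): **every abelian variety whose CM type has
`Rank > p^{k−1} + 1` is simple; nondegenerate ⟹ simple** — for EVERY abelian CM field of degree `2p^k`, `p` odd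
(the cyclic case, with the converse, is `DegenerateCMTypesCyclicCMFieldPrimePower.isSimple_iff_lt_cmTypeRank`).
THEOREMS ONLY.

## What is proved

* §1 (group level) **`orderOf_mul_card_filter_apply_eq_one`** (`ord(w)·#{χ : χ(w) = 1} = |G|`, any finite
  abelian group), **`eq_of_mul_self_eq_one`** (`|G| = 2p^k`: the involution is unique), **`card_oddChar_apply_eq_one`**
  (`p^e · #{χ odd : χ(v) = 1} = p^k`), `not_isStableUnder_of_mul_self_eq_one`, **`sum_char_eq_zero_of_isStableUnder`**,
  **`typeRank_le_of_isStableUnder`** (`∃ e ∈ [1, k], rank ≤ p^{k−e} + 1`), `forall_not_isStableUnder_of_lt_typeRank`.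
* §2 (abelian CM fields of degree `2p^k`) **`cmTypeRank_le_of_not_isPrimitive`** (`≤ p^{k−1} + 1`),
  **`isSimple_of_lt_cmTypeRank`** (+ coordinate-free `'`), **`isSimple_of_isNondegenerate`**,
  `isSimple_of_lt_cmTypeRank_fiftyFour` (degree `54`: `Rank > 10 ⟹` simple).

## References

* [Kubota1965] T. Kubota, Trans. AMS 118 (1965), §4 Lemma 2.
* [Dodson1987] B. Dodson, J. Algebra 111 (1987): Prop. 4.4 (1).
* [Shimura1998] G. Shimura, Abelian varieties with complex multiplication and modular functions, §8.2 Prop. 26,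
  §18.2 Lemma (i).
* [Hazama2003CyclicCM] F. Hazama, J. Math. Sci. Univ. Tokyo 10 (2003): Prop. 2.3, Lemma 4.6.1.
* [Gordon1999HodgeAVSurvey] B. Gordon, appendix to J. Lewis' survey (1999): Thm. 6.4.

## Provenance

Lane `lit-hodgefound` (Track 2, Layer A3/B), seat `lit-hodgefound-p10` generation 35, row g35-#21; neighbours
cited by name, nothing restated: `DegenerateCMTypesAbelianCMFieldPrimePower` (frame), `CMTypeRankCharacters`
(Kubota: `typeRank_eq_one_add_ncard_oddCharacters`), `DegenerateCMTypesCyclicCMFieldTwoOddPrimes`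
(`isPrimitive_iff`, `isCMTypeWith_galType`), Mathlib `PontryaginDuality` (`AddChar.sum_apply_eq_ite`, `AddChar.card_eq`).
-/

open scoped BigOperators NumberField IsMulCommutative Classical
open CategoryTheory NumberField

namespace Literature.AlgebraicGeometry.Pohlmann1968

namespace AbelianPrimePower

open Literature.NumberTheory.ComplexMultiplication
open Literature.NumberTheory.ComplexMultiplication.CyclicCMType
open Literature.AlgebraicGeometry.Motives (AbelianVariety CMType)
open Literature.AlgebraicGeometry.HodgeTheory
open Literature.AlgebraicGeometry.ComplexMultiplication (IsCMTypeRealisation isSimple_iff_isPrimitive)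
open Literature.AlgebraicGeometry.Pohlmann1968.CyclicTwoOddPrimes (gal_comm isCMTypeWith_galType
  cmTypeRank_eq_typeRank_galType)
open Literature.AlgebraicGeometry.ComplexMultiplication.CyclicTwoPower (exists_conj_gal)
open Dodson1984 (ncard_oddChar)

/-! ## §1 Counting the characters trivial at an element -/

section Group

variable {G : Type*} [CommGroup G] [Fintype G] [DecidableEq G] {p : ℕ} [hp : Fact p.Prime] {ρ : G} {Φ : Finset G}

omit [Fintype G] [DecidableEq G] hp in
/-- `χ(g^e) = χ(g)^e`. [folklore] -/
private theorem char_pow (χ : AddChar (Additive G) ℂ) (g : G) (e : ℕ) :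
    χ (Additive.ofMul (g ^ e)) = χ (Additive.ofMul g) ^ e := by
  rw [ofMul_pow, AddChar.map_nsmul_eq_pow]

omit [Fintype G] [DecidableEq G] hp in
/-- `χ(gh) = χ(g)χ(h)`. [folklore] -/
private theorem char_mul (χ : AddChar (Additive G) ℂ) (g h : G) :
    χ (Additive.ofMul (g * h)) = χ (Additive.ofMul g) * χ (Additive.ofMul h) := by
  rw [ofMul_mul, AddChar.map_add_eq_mul]

omit hp in
/-- **`ord(w) · #{χ : χ(w) = 1} = |G|`** (orthogonality of characters on the cyclic subgroup `⟨w⟩`).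
[cite: Kubota1965, §4 Lemma 2 (proof)] -/
theorem orderOf_mul_card_filter_apply_eq_one (w : G) :
    orderOf w * (Finset.univ.filter fun χ : AddChar (Additive G) ℂ => χ (Additive.ofMul w) = 1).card =
      Fintype.card G := by
  set m := orderOf w with hm
  have hm0 : 0 < m := orderOf_pos w
  -- `Σ_χ Σ_{i<m} χ(wⁱ)`, computed along `χ`
  have hrow : ∀ χ : AddChar (Additive G) ℂ, ∑ i ∈ Finset.range m, χ (Additive.ofMul (w ^ i)) =
      if χ (Additive.ofMul w) = 1 then (m : ℂ) else 0 := by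
    intro χ
    simp_rw [char_pow]
    split_ifs with h1
    · rw [h1]; simp
    · rw [geom_sum_eq h1, ← char_pow, pow_orderOf_eq_one, ofMul_one, AddChar.map_zero_eq_one, sub_self, zero_div]
  -- … and along `i`
  have hcol : ∀ i ∈ Finset.range m, ∑ χ : AddChar (Additive G) ℂ, χ (Additive.ofMul (w ^ i)) =
      if i = 0 then (Fintype.card G : ℂ) else 0 := by
    intro i hi
    rw [AddChar.sum_apply_eq_ite, Fintype.card_additive]
    have : (Additive.ofMul (w ^ i) = 0) ↔ i = 0 := by
      rw [show (0 : Additive G) = Additive.ofMul 1 from rfl, Additive.ofMul.injective.eq_iff,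
        ← orderOf_dvd_iff_pow_eq_one]
      constructor
      · intro hd
        exact Nat.eq_zero_of_dvd_of_lt hd (Finset.mem_range.1 hi)
      · rintro rfl; exact dvd_zero _
    simp only [this]
  have key : ∑ χ : AddChar (Additive G) ℂ, ∑ i ∈ Finset.range m, χ (Additive.ofMul (w ^ i)) =
      ∑ i ∈ Finset.range m, ∑ χ : AddChar (Additive G) ℂ, χ (Additive.ofMul (w ^ i)) := Finset.sum_comm
  rw [Finset.sum_congr rfl fun χ _ => hrow χ, Finset.sum_congr rfl hcol, Finset.sum_ite_eq',
    if_pos (Finset.mem_range.2 hm0), Finset.sum_ite, Finset.sum_const_zero, add_zero, Finset.sum_const,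
    nsmul_eq_mul] at key
  rw [mul_comm]
  exact_mod_cast key

omit [Fintype G] [DecidableEq G] hp in
/-- `χ(ρ) = ±1` for an involution `ρ`. [folklore] -/
private theorem apply_invol (hρ2 : ρ * ρ = 1) (χ : AddChar (Additive G) ℂ) :
    χ (Additive.ofMul ρ) = 1 ∨ χ (Additive.ofMul ρ) = -1 := by
  apply sq_eq_one_iff.1
  rw [sq, ← char_mul, hρ2, ofMul_one, AddChar.map_zero_eq_one]

/-- **A group of order `2p^k` (`p` odd) has a unique involution**: by character counting, two distinct commuting
involutions `u, ρ` would split the `|G|` characters into four classes of size `|G|/4` (Cauchy ∕ Sylow; here by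
the orthogonality relations). [cite: Kubota1965, §4 Lemma 2 (proof)] -/
theorem eq_of_mul_self_eq_one (hp2 : p ≠ 2) {k : ℕ} (hcard : Fintype.card G = 2 * p ^ k) (hρ1 : ρ ≠ 1)
    (hρ2 : ρ * ρ = 1) {u : G} (hu1 : u ≠ 1) (hu2 : u * u = 1) : u = ρ := by
  by_contra hne
  have horder : ∀ {v : G}, v ≠ 1 → v * v = 1 → orderOf v = 2 := by
    intro v hv1 hv2
    haveI : Fact (Nat.Prime 2) := ⟨Nat.prime_two⟩
    exact orderOf_eq_prime (by rw [sq, hv2]) hv1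
  have huρ1 : u * ρ ≠ 1 := by
    intro h
    apply hne
    calc u = u * (ρ * ρ) := by rw [hρ2, mul_one]
      _ = u * ρ * ρ := by rw [mul_assoc]
      _ = ρ := by rw [h, one_mul]
  have huρ2 : u * ρ * (u * ρ) = 1 := by
    calc u * ρ * (u * ρ) = u * u * (ρ * ρ) := by simp only [mul_assoc, mul_left_comm]
      _ = 1 := by rw [hu2, hρ2, one_mul]
  have Nu := orderOf_mul_card_filter_apply_eq_one (G := G) u
  have Nρ := orderOf_mul_card_filter_apply_eq_one (G := G) ρ
  have Nuρ := orderOf_mul_card_filter_apply_eq_one (G := G) (u * ρ)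
  rw [horder hu1 hu2] at Nu
  rw [horder hρ1 hρ2] at Nρ
  rw [horder huρ1 huρ2] at Nuρ
  -- the four classes
  set A := (Finset.univ.filter fun χ : AddChar (Additive G) ℂ =>
    χ (Additive.ofMul u) = 1 ∧ χ (Additive.ofMul ρ) = 1).card with hA
  set B := (Finset.univ.filter fun χ : AddChar (Additive G) ℂ =>
    χ (Additive.ofMul u) = 1 ∧ χ (Additive.ofMul ρ) = -1).card with hB
  set C := (Finset.univ.filter fun χ : AddChar (Additive G) ℂ =>
    χ (Additive.ofMul u) = -1 ∧ χ (Additive.ofMul ρ) = 1).card with hC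
  set D := (Finset.univ.filter fun χ : AddChar (Additive G) ℂ =>
    χ (Additive.ofMul u) = -1 ∧ χ (Additive.ofMul ρ) = -1).card with hD
  have hsplit : ∀ (P : AddChar (Additive G) ℂ → Prop) [DecidablePred P],
      (Finset.univ.filter P).card =
        (Finset.univ.filter fun χ => P χ ∧ χ (Additive.ofMul ρ) = 1).card +
          (Finset.univ.filter fun χ => P χ ∧ χ (Additive.ofMul ρ) = -1).card := by
    intro P _
    rw [← Finset.filter_filter, ← Finset.filter_filter,
      ← Finset.card_filter_add_card_filter_not (s := Finset.univ.filter P) (fun χ => χ (Additive.ofMul ρ) = 1)]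
    congr 2
    refine Finset.filter_congr fun χ _ => ?_
    rcases apply_invol hρ2 χ with h | h
    · rw [h]; norm_num
    · rw [h]; norm_num
  have h1 : (Finset.univ.filter fun χ : AddChar (Additive G) ℂ => χ (Additive.ofMul u) = 1).card = A + B :=
    hsplit _
  have h2 : (Finset.univ.filter fun χ : AddChar (Additive G) ℂ => χ (Additive.ofMul ρ) = 1).card = A + C := by
    rw [hsplit (fun χ => χ (Additive.ofMul ρ) = 1)]
    have e1 : (Finset.univ.filter fun χ : AddChar (Additive G) ℂ =>
        χ (Additive.ofMul ρ) = 1 ∧ χ (Additive.ofMul ρ) = 1).card = A + C := by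
      rw [hA, hC, ← Finset.card_union_of_disjoint]
      · congr 1; ext χ
        simp only [Finset.mem_filter, Finset.mem_univ, true_and, Finset.mem_union]
        rcases apply_invol hu2 χ with h | h <;> simp [h]
      · rw [Finset.disjoint_filter]; rintro χ - ⟨h, -⟩ ⟨h', -⟩; rw [h] at h'; norm_num at h'
    have e2 : (Finset.univ.filter fun χ : AddChar (Additive G) ℂ =>
        χ (Additive.ofMul ρ) = 1 ∧ χ (Additive.ofMul ρ) = -1).card = 0 := by
      rw [Finset.card_eq_zero, Finset.filter_eq_empty_iff]
      rintro χ - ⟨h, h'⟩; rw [h] at h'; norm_num at h'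
    rw [e1, e2, add_zero]
  have h3 : (Finset.univ.filter fun χ : AddChar (Additive G) ℂ => χ (Additive.ofMul (u * ρ)) = 1).card = A + D := by
    rw [hA, hD, ← Finset.card_union_of_disjoint]
    · congr 1; ext χ
      simp only [Finset.mem_filter, Finset.mem_univ, true_and, Finset.mem_union, char_mul]
      rcases apply_invol hu2 χ with h | h <;> rcases apply_invol hρ2 χ with h' | h' <;> simp [h, h'] <;> norm_num
    · rw [Finset.disjoint_filter]; rintro χ - ⟨h, -⟩ ⟨h', -⟩; rw [h] at h'; norm_num at h'
  have h4 : Fintype.card (AddChar (Additive G) ℂ) = A + B + (C + D) := by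
    rw [← Finset.card_univ, ← Finset.filter_true_of_mem (s := Finset.univ)
      (p := fun χ : AddChar (Additive G) ℂ => True) (fun _ _ => trivial), hsplit (fun _ => True)]
    simp only [true_and]
    have eB : (Finset.univ.filter fun χ : AddChar (Additive G) ℂ => χ (Additive.ofMul ρ) = 1).card = A + C := h2
    have eD : (Finset.univ.filter fun χ : AddChar (Additive G) ℂ => χ (Additive.ofMul ρ) = -1).card = B + D := by
      rw [hB, hD, ← Finset.card_union_of_disjoint]
      · congr 1; ext χ
        simp only [Finset.mem_filter, Finset.mem_univ, true_and, Finset.mem_union]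
        rcases apply_invol hu2 χ with h | h <;> simp [h]
      · rw [Finset.disjoint_filter]; rintro χ - ⟨h, -⟩ ⟨h', -⟩; rw [h] at h'; norm_num at h'
    rw [eB, eD]; ring
  rw [AddChar.card_eq, Fintype.card_additive] at h4
  rw [h1] at Nu; rw [h2] at Nρ; rw [h3] at Nuρ
  obtain ⟨m, hm⟩ : Odd (p ^ k) := (hp.out.odd_of_ne_two hp2).pow
  omega

/-- **The odd characters trivial at `v` of order `p^e` number `p^{k−e}`** (`|G| = 2p^k`).
[cite: Kubota1965, §4 Lemma 2 (proof)] -/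
theorem card_oddChar_apply_eq_one (hp2 : p ≠ 2) {k : ℕ} (hcard : Fintype.card G = 2 * p ^ k) (hρ1 : ρ ≠ 1)
    (hρ2 : ρ * ρ = 1) {v : G} {e : ℕ} (hv : orderOf v = p ^ e) :
    p ^ e * (Finset.univ.filter fun χ : AddChar (Additive G) ℂ =>
      χ (Additive.ofMul ρ) = -1 ∧ χ (Additive.ofMul v) = 1).card = p ^ k := by
  haveI : Fact (Nat.Prime 2) := ⟨Nat.prime_two⟩
  have hoρ : orderOf ρ = 2 := orderOf_eq_prime (by rw [sq, hρ2]) hρ1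
  have hodd : Odd (p ^ e) := (hp.out.odd_of_ne_two hp2).pow
  have hovρ : orderOf (v * ρ) = p ^ e * 2 := by
    rw [(Commute.all v ρ).orderOf_mul_eq_mul_orderOf_of_coprime, hv, hoρ]
    rw [hv, hoρ]; exact Nat.coprime_two_right.2 hodd
  have Nv := orderOf_mul_card_filter_apply_eq_one (G := G) v
  have Nvρ := orderOf_mul_card_filter_apply_eq_one (G := G) (v * ρ)
  rw [hv] at Nv
  rw [hovρ] at Nvρ
  -- `χ(vρ) = 1 ⟺ χ(v) = 1 ∧ χ(ρ) = 1`
  have hiff : (Finset.univ.filter fun χ : AddChar (Additive G) ℂ => χ (Additive.ofMul (v * ρ)) = 1) =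
      Finset.univ.filter fun χ : AddChar (Additive G) ℂ => χ (Additive.ofMul v) = 1 ∧ χ (Additive.ofMul ρ) = 1 := by
    refine Finset.filter_congr fun χ _ => ?_
    rw [char_mul]
    constructor
    · intro h
      rcases apply_invol hρ2 χ with h' | h'
      · rw [h', mul_one] at h; exact ⟨h, h'⟩
      · exfalso
        rw [h', mul_neg_one, neg_eq_iff_eq_neg] at h
        have := char_pow χ v (p ^ e)
        rw [← hv, pow_orderOf_eq_one, ofMul_one, AddChar.map_zero_eq_one, hv, h, hodd.neg_one_pow] at this
        norm_num at this
    · rintro ⟨h, h'⟩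
      rw [h, h', mul_one]
  -- split `χ(v) = 1` by the sign at `ρ`
  have hsplit : (Finset.univ.filter fun χ : AddChar (Additive G) ℂ => χ (Additive.ofMul v) = 1).card =
      (Finset.univ.filter fun χ : AddChar (Additive G) ℂ => χ (Additive.ofMul v) = 1 ∧ χ (Additive.ofMul ρ) = 1).card +
        (Finset.univ.filter fun χ : AddChar (Additive G) ℂ =>
          χ (Additive.ofMul ρ) = -1 ∧ χ (Additive.ofMul v) = 1).card := by
    rw [← Finset.card_union_of_disjoint]
    · congr 1; ext χ
      simp only [Finset.mem_filter, Finset.mem_univ, true_and, Finset.mem_union]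
      rcases apply_invol hρ2 χ with h | h
      · simp [h]
      · simp [h]; norm_num
    · rw [Finset.disjoint_filter]; rintro χ - ⟨-, h⟩ ⟨h', -⟩; rw [h] at h'; norm_num at h'
  rw [hiff] at Nvρ
  rw [hsplit, mul_add] at Nv
  have hpos : 0 < p ^ e := pow_pos hp.out.pos e
  have e1 : p ^ e * (Finset.univ.filter fun χ : AddChar (Additive G) ℂ =>
      χ (Additive.ofMul v) = 1 ∧ χ (Additive.ofMul ρ) = 1).card = p ^ k := by
    have := Nvρ; rw [hcard] at this
    nlinarith
  rw [hcard] at Nv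
  omega

/-- **An involution never stabilises a CM type** (it would be `ρ`). [cite: Shimura1998, §18.2 Lemma (i)] -/
theorem not_isStableUnder_of_mul_self_eq_one (hp2 : p ≠ 2) {k : ℕ} (hcard : Fintype.card G = 2 * p ^ k)
    (h : IsCMTypeWith ρ (Φ : Set G)) {u : G} (hu1 : u ≠ 1) (hu2 : u * u = 1) : ¬ IsStableUnder Φ u := by
  have hρ1 : ρ ≠ 1 := by
    intro h1; have := h.rho_smul_ne (1 : G); rw [h1, smul_eq_mul, one_mul] at this; exact this rfl
  have hρ2 : ρ * ρ = 1 := by have := h.invol (1 : G); simpa [smul_eq_mul] using this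
  have huρ := eq_of_mul_self_eq_one hp2 hcard hρ1 hρ2 hu1 hu2
  subst huρ
  intro hst
  obtain ⟨s, hs⟩ : Φ.Nonempty := by
    rw [Finset.nonempty_iff_ne_empty]
    rintro rfl
    have := (rho_mul_mem_iff h (1 : G)).2 (by simp)
    simp at this
  exact ((rho_mul_mem_iff h s).1 ((hst s).1 hs)) hs

omit [Fintype G] [DecidableEq G] hp in
/-- **A STABILISED TYPE HAS MANY VANISHING CHARACTERS**: if `uS = S` with `u ≠ 1`, every odd character with
`χ(u) ≠ 1` vanishes on `S` (`χ(S) = χ(uS) = χ(u)χ(S)`). [cite: Hazama2003CyclicCM, Prop. 2.3 and Lemma 4.6.1] -/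
theorem sum_char_eq_zero_of_isStableUnder {u : G} (hst : IsStableUnder Φ u) (χ : AddChar (Additive G) ℂ)
    (hχu : χ (Additive.ofMul u) ≠ 1) : ∑ s ∈ Φ, χ (Additive.ofMul s) = 0 := by
  have key : ∑ s ∈ Φ, χ (Additive.ofMul s) = χ (Additive.ofMul u) * ∑ s ∈ Φ, χ (Additive.ofMul s) := by
    rw [Finset.mul_sum]
    refine Finset.sum_bij (fun s _ => u⁻¹ * s) (fun s hs => ?_) (fun s _ s' _ hss' => mul_left_cancel hss')
      (fun s hs => ⟨u * s, (hst s).1 hs, by rw [inv_mul_cancel_left]⟩) (fun s _ => ?_)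
    · have := (hst (u⁻¹ * s)).2; rw [mul_inv_cancel_left] at this; exact this hs
    · rw [← char_mul, mul_inv_cancel_left]
  have : (1 - χ (Additive.ofMul u)) * ∑ s ∈ Φ, χ (Additive.ofMul s) = 0 := by rw [sub_mul, one_mul, ← key, sub_self]
  rcases mul_eq_zero.1 this with h0 | h0
  · exact absurd (sub_eq_zero.1 h0).symm hχu
  · exact h0

/-- **THE RANK OF AN IMPRIMITIVE TYPE on an abelian group of order `2p^k`**: if some `u ≠ 1` stabilises the CM type
`S`, then `rank(S) ≤ p^{k−1} + 1` — only the `p^{k−e}` odd characters trivial at a stabiliser `v` of order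
`p^e ≥ p` can fail to vanish. [cite: Kubota1965, §4 Lemma 2] [cite: Dodson1987, Prop. 4.4 (1)]
[cite: Hazama2003CyclicCM, Prop. 2.3] -/
theorem typeRank_le_of_isStableUnder (hp2 : p ≠ 2) {k : ℕ} (hcard : Fintype.card G = 2 * p ^ k)
    (h : IsCMTypeWith ρ (Φ : Set G)) {u : G} (hu1 : u ≠ 1) (hst : IsStableUnder Φ u) :
    ∃ e : ℕ, 1 ≤ e ∧ e ≤ k ∧ typeRank G (Φ : Set G) ≤ p ^ (k - e) + 1 := by
  have hρ1 : ρ ≠ 1 := by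
    intro h1; have := h.rho_smul_ne (1 : G); rw [h1, smul_eq_mul, one_mul] at this; exact this rfl
  have hρ2 : ρ * ρ = 1 := by have := h.invol (1 : G); simpa [smul_eq_mul] using this
  -- pass to `v = u²`, of order a power of `p`
  have hu2 : u * u ≠ 1 := fun hu2 => not_isStableUnder_of_mul_self_eq_one hp2 hcard h hu1 hu2 hst
  set v := u ^ 2 with hvdef
  have hv1 : v ≠ 1 := by rw [hvdef, sq]; exact hu2
  have hvst : IsStableUnder Φ v := hst.pow 2
  have hvk : v ^ p ^ k = 1 := by rw [hvdef, ← pow_mul, ← hcard, pow_card_eq_one]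
  obtain ⟨e, hek, he⟩ := (Nat.dvd_prime_pow hp.out).1 (orderOf_dvd_of_pow_eq_one hvk)
  have he1 : 1 ≤ e := by
    by_contra he0
    have : e = 0 := by omega
    rw [this, pow_zero, orderOf_eq_one_iff] at he
    exact hv1 he
  refine ⟨e, he1, hek, ?_⟩
  -- every odd character with `χ(v) ≠ 1` vanishes
  have hkub := h.typeRank_eq_one_add_ncard_oddCharacters
  have hsub : {χ : AddChar (Additive G) ℂ | χ (Additive.ofMul ρ) = -1 ∧ ∑ s ∈ Φ, χ (Additive.ofMul s) ≠ 0} ⊆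
      ↑(Finset.univ.filter fun χ : AddChar (Additive G) ℂ =>
        χ (Additive.ofMul ρ) = -1 ∧ χ (Additive.ofMul v) = 1) := by
    rintro χ ⟨hχ, hne⟩
    rw [Finset.coe_filter]
    refine ⟨Finset.mem_univ _, hχ, ?_⟩
    by_contra hv
    exact hne (sum_char_eq_zero_of_isStableUnder hvst χ hv)
  have hle := Set.ncard_le_ncard hsub (Set.toFinite _)
  rw [Set.ncard_coe_finset] at hle
  have hcount := card_oddChar_apply_eq_one hp2 hcard hρ1 hρ2 he
  have hpk : p ^ k = p ^ e * p ^ (k - e) := by rw [← pow_add, Nat.add_sub_cancel' hek]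
  rw [hpk] at hcount
  have hN := Nat.eq_of_mul_eq_mul_left (pow_pos hp.out.pos e) hcount
  rw [hkub]
  omega

/-- **Hence: rank `> p^{k−1} + 1` forces primitivity** (no non-trivial stabiliser).
[cite: Kubota1965, §4 Lemma 2] [cite: Dodson1987, Prop. 4.4 (1)] -/
theorem forall_not_isStableUnder_of_lt_typeRank (hp2 : p ≠ 2) {k : ℕ} (hcard : Fintype.card G = 2 * p ^ k)
    (h : IsCMTypeWith ρ (Φ : Set G)) (hlt : p ^ (k - 1) + 1 < typeRank G (Φ : Set G)) :
    ∀ u : G, u ≠ 1 → ¬ IsStableUnder Φ u := by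
  intro u hu1 hst
  obtain ⟨e, he1, hek, hle⟩ := typeRank_le_of_isStableUnder hp2 hcard h hu1 hst
  have : p ^ (k - e) ≤ p ^ (k - 1) := Nat.pow_le_pow_right hp.out.pos (by omega)
  omega

end Group

/-! ## §2 Abelian CM fields of degree `2p^k`: large rank forces simplicity -/

section Field

variable {K : Type} [Field K] [NumberField K] [IsCMField K] [Normal ℚ K] [IsMulCommutative (K ≃ₐ[ℚ] K)]
variable {p : ℕ} [hp : Fact p.Prime] {k : ℕ} {ρ : K ≃ₐ[ℚ] K} {φ₀ : K →+* ℂ}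
variable {Φ : CMType K} {A : AbelianVariety ℂ} {ι : 𝓞 K →+* End A} {θ : K →+* Module.End ℂ (complexBetti A.X 1)}

omit [IsCMField K] in
/-- **NON-PRIMITIVE TYPES HAVE SMALL RANK**: for an abelian CM field of degree `2p^k` (`p` odd), a CM type that is
not primitive has `Rank ≤ p^{k−1} + 1`. [cite: Kubota1965, §4 Lemma 2] [cite: Dodson1987, Prop. 4.4 (1)]
[cite: Shimura1998, §8.2 Prop. 26] -/
theorem cmTypeRank_le_of_not_isPrimitive (hp2 : p ≠ 2) (hρ : ∀ x, φ₀ (ρ x) = starRingEnd ℂ (φ₀ x))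
    (hK : Module.finrank ℚ K = 2 * p ^ k) (Φ : CMType K) {φh : K →+* ℂ}
    (hnp : ¬ IsPrimitive (ℂ ≃+* ℂ) Φ.1 φh) : cmTypeRank Φ ≤ p ^ (k - 1) + 1 := by
  have hcardG : Fintype.card (K ≃ₐ[ℚ] K) = 2 * p ^ k := by rw [card_gal_eq_finrank φ₀, hK]
  rw [CyclicTwoOddPrimes.isPrimitive_iff (φ₀ := φ₀) Φ φh] at hnp
  by_contra hlt
  rw [not_le, cmTypeRank_eq_typeRank_galType Φ φ₀] at hlt
  exact hnp (forall_not_isStableUnder_of_lt_typeRank hp2 hcardG (isCMTypeWith_galType hρ Φ) hlt)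

omit [IsCMField K] in
/-- **LARGE RANK FORCES SIMPLICITY**: for an abelian CM field of degree `2p^k` (`p` odd), every abelian variety of a
type with `Rank > p^{k−1} + 1` is SIMPLE. [cite: Kubota1965, §4 Lemma 2] [cite: Shimura1998, §8.2 Prop. 26]
[cite: Dodson1987, Prop. 4.4 (1)] -/
theorem isSimple_of_lt_cmTypeRank (hp2 : p ≠ 2) (hρ : ∀ x, φ₀ (ρ x) = starRingEnd ℂ (φ₀ x))
    (hK : Module.finrank ℚ K = 2 * p ^ k) (hA : IsCMTypeRealisation Φ A ι θ)
    (hlt : p ^ (k - 1) + 1 < cmTypeRank Φ) : A.IsSimple := by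
  rw [isSimple_iff_isPrimitive hA φ₀]
  by_contra hnp
  have := cmTypeRank_le_of_not_isPrimitive hp2 hρ hK Φ hnp
  omega

omit hp in
/-- **Coordinate-free: `Rank > p^{k−1} + 1 ⟹ A` simple; in particular NONDEGENERATE ⟹ simple** (`k ≥ 1`).
[cite: Kubota1965, §4 Lemma 2] [cite: Shimura1998, §8.2 Prop. 26] -/
theorem isSimple_of_lt_cmTypeRank' (hprime : p.Prime) (hp2 : p ≠ 2) (hK : Module.finrank ℚ K = 2 * p ^ k)
    (hA : IsCMTypeRealisation Φ A ι θ) (hlt : p ^ (k - 1) + 1 < cmTypeRank Φ) : A.IsSimple := by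
  haveI : Fact p.Prime := ⟨hprime⟩
  obtain ⟨φ₀⟩ := (inferInstance : Nonempty (K →+* ℂ))
  obtain ⟨ρ, hρall⟩ := exists_conj_gal (K := K)
  exact isSimple_of_lt_cmTypeRank hp2 (hρall φ₀) hK hA hlt

omit hp in
/-- **Nondegenerate ⟹ simple** for abelian CM fields of degree `2p^k`, `k ≥ 1`, `p` odd. [cite: Kubota1965, §4 Lemma 2]
[cite: Gordon1999HodgeAVSurvey, Thm. 6.4] -/
theorem isSimple_of_isNondegenerate (hprime : p.Prime) (hp2 : p ≠ 2) (hk : 1 ≤ k)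
    (hK : Module.finrank ℚ K = 2 * p ^ k) (hA : IsCMTypeRealisation Φ A ι θ) (hnd : IsNondegenerate Φ) :
    A.IsSimple := by
  haveI : Fact p.Prime := ⟨hprime⟩
  refine isSimple_of_lt_cmTypeRank' hprime hp2 hK hA ?_
  rw [_root_.Literature.AlgebraicGeometry.Pohlmann1968.isNondegenerate_iff, CyclicPrimePower.finrank_div_two_eq hK]
    at hnd
  rw [hnd]
  have : p ^ (k - 1) < p ^ k := Nat.pow_lt_pow_right hprime.one_lt (by omega)
  omega

omit hp in
/-- **Degree `54`, any abelian CM field: `Rank > 10 ⟹` simple.** [cite: Dodson1987, Prop. 4.4 (1)]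
[cite: Kubota1965, §4 Lemma 2] -/
theorem isSimple_of_lt_cmTypeRank_fiftyFour (hK : Module.finrank ℚ K = 54) (hA : IsCMTypeRealisation Φ A ι θ)
    (hlt : 10 < cmTypeRank Φ) : A.IsSimple := by
  have hK' : Module.finrank ℚ K = 2 * 3 ^ 3 := by rw [hK]; norm_num
  exact isSimple_of_lt_cmTypeRank' Nat.prime_three (by norm_num) hK' hA (by norm_num; omega)

end Field

end AbelianPrimePower

end Literature.AlgebraicGeometry.Pohlmann1968
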